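import Summits.PneNP.PneNP.Theorems.ChebyshevTracialDesignRungCorollaries
import Summits.PneNP.PneNP.Theorems.ChebyshevTracialDesignRectangleDecayAll
import Summits.PneNP.PneNP.Theorems.ChebyshevTracialDesignTightMassWeighted
import Summits.PneNP.PneNP.Theorems.ChebyshevTracialDesignDictionary
import Literature.Combinatorics.Additive.LevelDInequalitySn
import HarnessLib

/-!
# Cell pnp-psdrank, route `ChebyshevTracialDesign`: THE RUNGS ARE UNCONDITIONAL — the `r = 1` rung, SNT, the `r = 2` dense cell and the
# bounded-dimension / commutative / dictionary cases of the crux, with Keevash–Lifshitz Thm 1.8 DISCHARGED (crux `TracialDecayExp20`, stmt-PneNP-19878)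

Brick 81 (prover g14). Every analytic brick of the cell's `r = 1` / `r = 2` programme was proved modulo ONE named fact, Keevash–Lifshitz's level-`d`
inequality for global functions on `S_n` (`Literature.Combinatorics.Additive.KeevashLifshitz.GlobalLevelDInequality`, arXiv:2307.15030 Thm 1.8), carried
as a binder `(hKL : GlobalLevelDInequality)` in 16 `ChebyshevTracialDesign*` files (31 binders). The literature seat (lit g23, LIT-26 Milestone X) has
now PROVED it in the kernel: `GlobalLevelDInequality_holds` (`Literature/Combinatorics/Additive/LevelDInequalitySn.lean`, p577118, via Keller–Lifshitz–Marcus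
Thm 5.4 on general product spaces, ≈ 5.2k lines, 0 sorry). This file feeds the proof to the HEADLINE conditional theorems, so that the following are now
theorems of the tree with axioms ⊆ {propext, Classical.choice, Quot.sound} and NO hypothesis:
* `rectangleDecayExp_holds` — THE `r = 1` RUNG OF THE CRUX at the exp scale (Rothvoß-type rectangle decay `≤ exp(−a·dq n)` for every balanced
  Chebyshev design of degree `dq n ≍ n^{1/4}`); `rectangleDecayExp_all_holds` (all rectangles, `≤ 20·exp(−a·dq n)`); `rectangleSqSlackDecay_holds`;
* `tracialDecayExp_dimOne_holds`, `tracialDecayExp_boundedDim_holds` (the crux at every FIXED dimension `r ≤ r₀`, rate `a/(8(r₀+1))`),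
  `tracialDecayExp_commutative_holds`, `tracialDecayExp_blockDiagonal_holds`, `tracialDecayExp_cutDictionary_holds`,
  `tracialDecayExp_cutFiniteValued_holds`, `tracialDecayExp_cutEigenbasis_holds` (the structured-strategy cases of the crux, no dimension budget);
* `snt_sym_oddSet_holds` (SPECTRAL NON-TIGHTNESS: dense cut families × homogeneous-dense matching families contain a tight pair), `weightedSNT_holds`,
  `tight_mass_ge_holds` (mass form), `denseCell_dim_two_holds` (THE `r = 2` DENSE NON-CROSSING PSD CELL).
What remains OPEN is exactly the crux `TracialDecayExp20` itself: ONE rate `a` for all dimensions `r` with `r²n < exp(a·dq n)` (brick 80: equivalently for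
nowhere-zero strategies). [cite: KeevashLifshitz2023, Thm. 1.8] [cite: KellerLifshitzMarcus2023, Thm. 5.4] [cite: Rothvoss2017, §2 and Lemma 7 (PDF pp. 6–8)]
[cite: KupavskiiZakharov2022, Lemma 11] [cite: BrietDadushPokutta2014, Thm. 6 (§3)]
Stature: support/instrument — these are RUNG-level results (the `r = 1` rung is the psd-free shadow of the crux; the others are structured or
small-dimension cases); the statements are unchanged from the conditional bricks, only the hypothesis is discharged. WHAT THIS IS NOT: not the crux,
nothing on psd rank of P_PM(K_n) beyond what the rungs say, no P-vs-NP content.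
-/

set_option linter.dupNamespace false -- `Summit.PneNP.PneNP.…`: summit = sub-problem (D-0017)

noncomputable section

namespace Summit.PneNP.PneNP.Theorems.ChebyshevTracialDesignUnconditionalRungs

open scoped Classical
open Finset Matrix Literature.Barriers.PneNP Literature.Combinatorics.Optimization
open Literature.Combinatorics.SetFamily
open Literature.Combinatorics.AssociationSchemes.HomogeneousMatchingFamilies
open Literature.Combinatorics.Additive.KeevashLifshitz

variable {n : ℕ}

/-- **THE `r = 1` RUNG AT THE EXP SCALE — UNCONDITIONAL.** For some `a > 0` and all large even `n`: every balanced exact design `(t, C, w)` of degree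
`dq n` on levels `≤ Tq n` with `Σ|w_c| ≤ 20` gives every tight-free rectangle `A × B` of odd cuts × perfect matchings mass `≤ exp(−a·dq n)` —
Rothvoß's rectangle lemma at the stretched-exponential scale for Chebyshev designs, now axiom-free (KL Thm 1.8 discharged by lit g23).
[cite: Rothvoss2017, §2 and Lemma 7 (PDF pp. 6–8)] [cite: KeevashLifshitz2023, Thm. 1.8] [cite: KupavskiiZakharov2022, Lemma 11] -/
theorem rectangleDecayExp_holds :
    ∃ a : ℝ, 0 < a ∧ ∃ n₁ : ℕ, ∀ n : ℕ, n₁ ≤ n → Even n → ∀ (t : ℕ) (C : Finset ℕ) (w : ℕ → ℝ),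
      IsBalancedDesign n t (Tq n) (dq n) 20 C w →
        ∀ (A : Finset (OddSet n)) (B : Finset (PMatch n)), (∀ U ∈ A, ∀ M ∈ B, cc U M ≠ 1) →
          ∑ U ∈ A, ∑ M ∈ B, levelWeight n t C w U M ≤ Real.exp (-(a * (dq n : ℝ))) :=
  Summit.PneNP.PneNP.Theorems.ChebyshevTracialDesignRungAssembly.rectangleDecayExp_of_globalLevelD GlobalLevelDInequality_holds

/-- **THE CRUX AT EVERY BOUNDED DIMENSION — UNCONDITIONAL**: for some `a > 0` and every `r₀`, for all large even `n` every balanced `B = 20` design weight has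
tracial value `≤ exp(−(a/(8(r₀+1)))·dq n)` on tight-orthogonal psd rectangles of every dimension `1 ≤ r ≤ r₀`. (The crux `TracialDecayExp20` asks one rate for all
`r²n < exp(a·dq n)`; that growth of `r` with `n` is the open part.) [cite: Rothvoss2017, §2 (PDF p. 6)] [cite: KeevashLifshitz2023, Thm. 1.8] -/
theorem tracialDecayExp_boundedDim_holds :
    ∃ a : ℝ, 0 < a ∧ ∀ r₀ : ℕ, ∃ n₁ : ℕ, ∀ n : ℕ, n₁ ≤ n → Even n → ∀ (t : ℕ) (C : Finset ℕ) (w : ℕ → ℝ),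
      IsBalancedDesign n t (Tq n) (dq n) 20 C w → ∀ r : ℕ, 0 < r → r ≤ r₀ →
        TracialValueLEAt (levelWeight n t C w) (Real.exp (-(a / (8 * ((r₀ : ℝ) + 1)) * (dq n : ℝ)))) r :=
  Summit.PneNP.PneNP.Theorems.ChebyshevTracialDesignRungAssembly.tracialDecayExp_boundedDim_of_globalLevelD GlobalLevelDInequality_holds

/-- **The crux in dimension one — UNCONDITIONAL.** [cite: Rothvoss2017, §2 (PDF p. 6)] [cite: KeevashLifshitz2023, Thm. 1.8] -/
theorem tracialDecayExp_dimOne_holds :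
    ∃ a : ℝ, 0 < a ∧ ∃ n₁ : ℕ, ∀ n : ℕ, n₁ ≤ n → Even n → ∀ (t : ℕ) (C : Finset ℕ) (w : ℕ → ℝ),
      IsBalancedDesign n t (Tq n) (dq n) 20 C w →
        TracialValueLEAt (levelWeight n t C w) (Real.exp (-(a * (dq n : ℝ)))) 1 :=
  Summit.PneNP.PneNP.Theorems.ChebyshevTracialDesignRungCorollaries.tracialDecayExp_dimOne_of_globalLevelD GlobalLevelDInequality_holds

/-- **The crux on COMMUTATIVE strategies of every dimension — UNCONDITIONAL** (common orthonormal eigenbasis; no dimension budget).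
[cite: Rothvoss2017, §2 (PDF pp. 6–7)] [cite: BrietDadushPokutta2014, Thm. 6 (§3)] [cite: KeevashLifshitz2023, Thm. 1.8] -/
theorem tracialDecayExp_commutative_holds :
    ∃ a : ℝ, 0 < a ∧ ∃ n₁ : ℕ, ∀ n : ℕ, n₁ ≤ n → Even n → ∀ (t : ℕ) (C : Finset ℕ) (w : ℕ → ℝ),
      IsBalancedDesign n t (Tq n) (dq n) 20 C w → ∀ (r : ℕ), 0 < r →
        ∀ (O : Matrix (Fin r) (Fin r) ℝ), Oᵀ * O = 1 → ∀ (x : OddSet n → Fin r → ℝ) (y : PMatch n → Fin r → ℝ)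
          (X : OddSet n → Matrix (Fin r) (Fin r) ℝ) (Y : PMatch n → Matrix (Fin r) (Fin r) ℝ),
          (∀ U, X U = O * diagonal (x U) * Oᵀ) → (∀ M, Y M = O * diagonal (y M) * Oᵀ) → IsPsdRect X Y →
            (∑ U, ∑ M, levelWeight n t C w U M * (X U * Y M).trace) / r ≤ Real.exp (-(a * (dq n : ℝ))) :=
  Summit.PneNP.PneNP.Theorems.ChebyshevTracialDesignRungCorollaries.tracialDecayExp_commutative_of_globalLevelD GlobalLevelDInequality_holds

/-- **The crux on BLOCK-DIAGONAL strategies with bounded blocks — UNCONDITIONAL.** [cite: Rothvoss2017, §2 (PDF p. 6)] [cite: KeevashLifshitz2023, Thm. 1.8] -/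
theorem tracialDecayExp_blockDiagonal_holds :
    ∃ a : ℝ, 0 < a ∧ ∀ d₀ : ℕ, ∃ n₁ : ℕ, ∀ n : ℕ, n₁ ≤ n → Even n → ∀ (t : ℕ) (C : Finset ℕ) (w : ℕ → ℝ),
      IsBalancedDesign n t (Tq n) (dq n) 20 C w → ∀ (r m : ℕ), 0 < r → ∀ (blk : Fin r → Fin m),
        (∀ b : Fin m, Fintype.card {i : Fin r // blk i = b} ≤ d₀) →
        ∀ (X : OddSet n → Matrix (Fin r) (Fin r) ℝ) (Y : PMatch n → Matrix (Fin r) (Fin r) ℝ), IsPsdRect X Y →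
          (∀ U i j, blk i ≠ blk j → X U i j = 0) → (∀ M i j, blk i ≠ blk j → Y M i j = 0) →
            (∑ U, ∑ M, levelWeight n t C w U M * (X U * Y M).trace) / r ≤
              Real.exp (-(a / (8 * ((d₀ : ℝ) + 1)) * (dq n : ℝ))) :=
  Summit.PneNP.PneNP.Theorems.ChebyshevTracialDesignRungCorollaries.tracialDecayExp_blockDiagonal_of_globalLevelD GlobalLevelDInequality_holds

/-- **The `r = 1` rung for ALL rectangles (tight-free or not) — UNCONDITIONAL**: mass `≤ 20·exp(−a·dq n)`.
[cite: KeevashLifshitz2023, Thm. 1.8] [cite: Rothvoss2017, §2 and Lemma 7 (PDF pp. 6–8)] [cite: KupavskiiZakharov2022, Lemma 11] -/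
theorem rectangleDecayExp_all_holds :
    ∃ a : ℝ, 0 < a ∧ ∃ n₁ : ℕ, ∀ n : ℕ, n₁ ≤ n → Even n → ∀ (t : ℕ) (C : Finset ℕ) (w : ℕ → ℝ),
      IsBalancedDesign n t (Tq n) (dq n) 20 C w →
        ∀ (A : Finset (OddSet n)) (B : Finset (PMatch n)),
          ∑ U ∈ A, ∑ M ∈ B, levelWeight n t C w U M ≤ 20 * Real.exp (-(a * (dq n : ℝ))) :=
  Summit.PneNP.PneNP.Theorems.ChebyshevTracialDesignRectangleDecayAll.rectangleDecayExp_all_of_globalLevelD GlobalLevelDInequality_holds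

/-- **Rectangle decay for the squared-slack weight `W·(cc−1)²` — UNCONDITIONAL** (mass `≤ 20·Tq(n)²·exp(−a·dq n)` on every rectangle).
[cite: KeevashLifshitz2023, Thm. 1.8] [cite: Rothvoss2017, §2 (PDF pp. 6–8)] -/
theorem rectangleSqSlackDecay_holds :
    ∃ a : ℝ, 0 < a ∧ ∃ n₁ : ℕ, ∀ n : ℕ, n₁ ≤ n → Even n → ∀ (t : ℕ) (C : Finset ℕ) (w : ℕ → ℝ),
      IsBalancedDesign n t (Tq n) (dq n) 20 C w →
        ∀ (A : Finset (OddSet n)) (B : Finset (PMatch n)),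
          ∑ U ∈ A, ∑ M ∈ B, levelWeight n t C (fun c => w c * ((c : ℝ) - 1) ^ 2) U M ≤
            20 * (Tq n : ℝ) ^ 2 * Real.exp (-(a * (dq n : ℝ))) :=
  Summit.PneNP.PneNP.Theorems.ChebyshevTracialDesignRectangleDecayAll.rectangleSqSlackDecay_of_globalLevelD GlobalLevelDInequality_holds

/-- **SPECTRAL NON-TIGHTNESS (SNT) — UNCONDITIONAL**: for `τ ≥ 1` there are `c₀ > 0`, `n₁` such that for even `n ≥ n₁`, odd balanced `t`, every family
of `t`-cuts of density `≥ exp(−c₀·dq n)` and every `(PM_n, τ)`-homogeneous set of perfect matchings of density `≥ exp(−c₀·dq n)` contain a TIGHT pair.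
[cite: KeevashLifshitz2023, Thm. 1.8] [cite: KupavskiiZakharov2022, §2] [cite: Rothvoss2017, §2 (PDF pp. 5–6)] -/
theorem snt_sym_oddSet_holds {τ : ℝ} (hτ : 1 ≤ τ) :
    ∃ c₀ : ℝ, 0 < c₀ ∧ ∃ n₁ : ℕ, ∀ (n t : ℕ), n₁ ≤ n → Even n → Odd t → n ≤ 5 * t → n ≤ 5 * (n - t) →
      ∀ (X : Finset (OddSet n)), (∀ U ∈ X, U.1.card = t) →
      ∀ (Y : Finset (PMatch n)), IsRelHomogeneous τ (perfectMatchings (univ : Finset (Fin n))) (Y.image Subtype.val) →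
      Real.exp (-(c₀ * dq n)) ≤ (X.card : ℝ) / (n.choose t : ℝ) →
      Real.exp (-(c₀ * dq n)) ≤ (Y.card : ℝ) / (Fintype.card (PMatch n) : ℝ) →
      ∃ U ∈ X, ∃ M ∈ Y, cc U M = 1 :=
  Summit.PneNP.PneNP.Theorems.ChebyshevTracialDesignSpectralNonTightnessWide.snt_sym_oddSet_of_globalLevelD GlobalLevelDInequality_holds hτ

/-- **WEIGHTED SNT — UNCONDITIONAL** (`τ ≥ 2`; cut weights `x ∈ [0,1]` of density `ε`, homogeneous matching weights `z` of density `ν`, thresholds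
`exp(−c₀·dq n)`): some active pair is tight. [cite: KeevashLifshitz2023, Thm. 1.8] [cite: KupavskiiZakharov2022, §2] [cite: Rothvoss2017, §2 (PDF p. 6)] -/
theorem weightedSNT_holds {τ : ℝ} (hτ : 2 ≤ τ) :
    ∃ c₀ : ℝ, 0 < c₀ ∧ ∃ n₁ : ℕ, ∀ (n t : ℕ), n₁ ≤ n → Even n → Odd t → n ≤ 5 * t → n ≤ 5 * (n - t) →
      ∀ (ε ν : ℝ), Real.exp (-(c₀ * dq n)) ≤ ε → Real.exp (-(c₀ * dq n)) ≤ ν →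
      ∀ (x : OddSet n → ℝ) (z : PMatch n → ℝ), (∀ U, 0 ≤ x U ∧ x U ≤ 1) → (∀ U, U.1.card ≠ t → x U = 0) →
      ε * ((univ.filter fun U : OddSet n => U.1.card = t).card : ℝ) ≤ ∑ U, x U → (∀ M, 0 ≤ z M ∧ z M ≤ 1) →
      IsRelHomogeneousW τ (perfectMatchings (univ : Finset (Fin n)))
        (fun M : Finset (Sym2 (Fin n)) => if hM : IsPMOn (univ : Finset (Fin n)) M then z ⟨M, hM⟩ else 0)
        ((univ : Finset (PMatch n)).image Subtype.val) →
      ν * (Fintype.card (PMatch n) : ℝ) ≤ ∑ M, z M → ∃ U M, cc U M = 1 ∧ 0 < x U ∧ 0 < z M :=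
  Summit.PneNP.PneNP.Theorems.ChebyshevTracialDesignWeightedSNT.weightedSNT_of_globalLevelD GlobalLevelDInequality_holds hτ

/-- **THE `r = 2` DENSE NON-CROSSING PSD CELL — UNCONDITIONAL** (brick 63/65: value `≤ 6γ + 4·B_v·ε` for homogeneous-dense matching trace weight).
[cite: KeevashLifshitz2023, Thm. 1.8] [cite: KupavskiiZakharov2022, §2] [cite: Rothvoss2017, §2 (PDF p. 6)] -/
theorem denseCell_dim_two_holds :
    ∃ c₀ : ℝ, 0 < c₀ ∧ ∃ n₁ : ℕ, ∀ (n t : ℕ), n₁ ≤ n → Even n → Odd t → n ≤ 5 * t → n ≤ 5 * (n - t) →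
      ∀ (C : Finset ℕ) (w : ℕ → ℝ) (Bv γ ε ν : ℝ), ∑ c ∈ C, |w c| ≤ Bv →
      Real.exp (-(c₀ * dq n)) ≤ ε → Real.exp (-(c₀ * dq n)) ≤ ν →
      TracialValueLEAt (levelWeight n t C w) γ 1 →
      ∀ (X : OddSet n → Matrix (Fin 2) (Fin 2) ℝ) (Y : PMatch n → Matrix (Fin 2) (Fin 2) ℝ), IsPsdRect X Y →
      (∀ U, U.1.card ≠ t → X U = 0) →
      IsRelHomogeneousW (Real.exp 1) (perfectMatchings (univ : Finset (Fin n)))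
        (fun M : Finset (Sym2 (Fin n)) => if hM : IsPMOn (univ : Finset (Fin n)) M then (Y ⟨M, hM⟩).trace / 2 else 0)
        ((univ : Finset (PMatch n)).image Subtype.val) →
      4 * (ν * (Fintype.card (PMatch n) : ℝ)) ≤ ∑ M, (Y M).trace / 2 →
      ∑ U, ∑ M, levelWeight n t C w U M * (X U * Y M).trace ≤ 6 * γ + 4 * Bv * ε :=
  Summit.PneNP.PneNP.Theorems.ChebyshevTracialDesignWeightedSNT.denseCell_dim_two_of_globalLevelD GlobalLevelDInequality_holds

/-- **WEIGHTED SNT, MASS FORM — UNCONDITIONAL** (brick 70b: the tight mass of a dense × homogeneous-dense weighted rectangle is `≥ (29/960)·μ·ν·|Q_1(t)|`).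
[cite: KeevashLifshitz2023, Thm. 1.8] [cite: KupavskiiZakharov2022, §2] [cite: Rothvoss2017, §2 (PDF p. 6)] [cite: AlonSpencer2016, Appendix A.1] -/
theorem tight_mass_ge_holds {τ : ℝ} (hτ : 2 ≤ τ) :
    ∃ c₀ : ℝ, 0 < c₀ ∧ ∃ n₁ : ℕ, ∀ (n t : ℕ), n₁ ≤ n → Even n → Odd t → n ≤ 5 * t → n ≤ 5 * (n - t) →
      ∀ (ε ν : ℝ), Real.exp (-(c₀ * dq n)) ≤ ε → Real.exp (-(c₀ * dq n)) ≤ ν →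
      ∀ (x : OddSet n → ℝ) (z : PMatch n → ℝ), (∀ U, 0 ≤ x U ∧ x U ≤ 1) → (∀ U, U.1.card ≠ t → x U = 0) →
      ε * ((univ.filter fun U : OddSet n => U.1.card = t).card : ℝ) ≤ ∑ U, x U → (∀ M, 0 ≤ z M ∧ z M ≤ 1) →
      IsRelHomogeneousW τ (perfectMatchings (univ : Finset (Fin n)))
        (fun M : Finset (Sym2 (Fin n)) => if hM : IsPMOn (univ : Finset (Fin n)) M then z ⟨M, hM⟩ else 0)
        ((univ : Finset (PMatch n)).image Subtype.val) →
      ν * (Fintype.card (PMatch n) : ℝ) ≤ ∑ M, z M →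
      (29 / 960 : ℝ) * ((∑ U, x U) / ((univ.filter fun U : OddSet n => U.1.card = t).card : ℝ)) *
          ((∑ M, z M) / (Fintype.card (PMatch n) : ℝ)) * ((Qset n t 1).card : ℝ) ≤
        ∑ U, ∑ M, x U * z M * (if cc U M = 1 then (1 : ℝ) else 0) :=
  Summit.PneNP.PneNP.Theorems.ChebyshevTracialDesignTightMassWeighted.tight_mass_ge_of_globalLevelD GlobalLevelDInequality_holds hτ

/-- **The crux for CUT-SIDE DICTIONARY strategies (dictionary of size `≤ r·exp(a·dq n)`) — UNCONDITIONAL.**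
[cite: Rothvoss2017, §2 (PDF pp. 6–8)] [cite: KeevashLifshitz2023, Thm. 1.8] -/
theorem tracialDecayExp_cutDictionary_holds :
    ∃ a : ℝ, 0 < a ∧ ∃ n₁ : ℕ, ∀ n : ℕ, n₁ ≤ n → Even n → ∀ (t : ℕ) (C : Finset ℕ) (w : ℕ → ℝ),
      IsBalancedDesign n t (Tq n) (dq n) 20 C w → ∀ (r : ℕ), 0 < r → ∀ (ι : Type) [Fintype ι],
        (Fintype.card ι : ℝ) ≤ r * Real.exp (a * (dq n : ℝ)) →
        ∀ (v : ι → Fin r → ℝ), (∀ d, v d ⬝ᵥ v d ≤ 1) → ∀ (lam : OddSet n → ι → ℝ), (∀ U d, 0 ≤ lam U d ∧ lam U d ≤ 1) →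
        ∀ (X : OddSet n → Matrix (Fin r) (Fin r) ℝ) (Y : PMatch n → Matrix (Fin r) (Fin r) ℝ), IsPsdRect X Y →
          (∀ U, X U = ∑ d, lam U d • vecMulVec (v d) (v d)) →
            (∑ U, ∑ M, levelWeight n t C w U M * (X U * Y M).trace) / r ≤ Real.exp (-(a * (dq n : ℝ))) :=
  Summit.PneNP.PneNP.Theorems.ChebyshevTracialDesignDictionary.tracialDecayExp_cutDictionary_of_globalLevelD GlobalLevelDInequality_holds

/-- **The crux for FINITE-VALUED cut sides (`≤ exp(a·dq n)` distinct operators) — UNCONDITIONAL.**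
[cite: Rothvoss2017, §2 (PDF pp. 6–8)] [cite: KeevashLifshitz2023, Thm. 1.8] -/
theorem tracialDecayExp_cutFiniteValued_holds :
    ∃ a : ℝ, 0 < a ∧ ∃ n₁ : ℕ, ∀ n : ℕ, n₁ ≤ n → Even n → ∀ (t : ℕ) (C : Finset ℕ) (w : ℕ → ℝ),
      IsBalancedDesign n t (Tq n) (dq n) 20 C w → ∀ (r : ℕ), 0 < r → ∀ (ι : Type) [Fintype ι],
        (Fintype.card ι : ℝ) ≤ Real.exp (a * (dq n : ℝ)) → ∀ (κ : OddSet n → ι) (P : ι → Matrix (Fin r) (Fin r) ℝ)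
        (X : OddSet n → Matrix (Fin r) (Fin r) ℝ) (Y : PMatch n → Matrix (Fin r) (Fin r) ℝ), IsPsdRect X Y →
          (∀ U, X U = P (κ U)) →
            (∑ U, ∑ M, levelWeight n t C w U M * (X U * Y M).trace) / r ≤ Real.exp (-(a * (dq n : ℝ))) :=
  Summit.PneNP.PneNP.Theorems.ChebyshevTracialDesignDictionary.tracialDecayExp_cutFiniteValued_of_globalLevelD GlobalLevelDInequality_holds

/-- **The crux for cut sides with a COMMON EIGENBASIS (matching side arbitrary) — UNCONDITIONAL.**
[cite: Rothvoss2017, §2 (PDF pp. 6–8)] [cite: BrietDadushPokutta2014, Thm. 6 (§3)] [cite: KeevashLifshitz2023, Thm. 1.8] -/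
theorem tracialDecayExp_cutEigenbasis_holds :
    ∃ a : ℝ, 0 < a ∧ ∃ n₁ : ℕ, ∀ n : ℕ, n₁ ≤ n → Even n → ∀ (t : ℕ) (C : Finset ℕ) (w : ℕ → ℝ),
      IsBalancedDesign n t (Tq n) (dq n) 20 C w → ∀ (r : ℕ), 0 < r →
        ∀ (O : Matrix (Fin r) (Fin r) ℝ), Oᵀ * O = 1 → ∀ (x : OddSet n → Fin r → ℝ)
          (X : OddSet n → Matrix (Fin r) (Fin r) ℝ) (Y : PMatch n → Matrix (Fin r) (Fin r) ℝ),
          (∀ U, X U = O * diagonal (x U) * Oᵀ) → IsPsdRect X Y →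
            (∑ U, ∑ M, levelWeight n t C w U M * (X U * Y M).trace) / r ≤ Real.exp (-(a * (dq n : ℝ))) :=
  Summit.PneNP.PneNP.Theorems.ChebyshevTracialDesignDictionary.tracialDecayExp_cutEigenbasis_of_globalLevelD GlobalLevelDInequality_holds

end Summit.PneNP.PneNP.Theorems.ChebyshevTracialDesignUnconditionalRungs
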